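import Summits.HodgeConjecture.HodgeConjecture.Theorems.F0P2aL2cPNullSpanOrthogonal
import Summits.HodgeConjecture.HodgeConjecture.Theorems.F0P2aL2cEngineDictionary
import Literature.NumberTheory.Automorphic.AutomorphicAnalyticVectorsGeneral
import Literature.NumberTheory.Automorphic.AutomorphicLieDerivSkewAdjoint
import Literature.NumberTheory.Automorphic.AutomorphicRepsGLClosureRegularity
import Literature.AlgebraicGeometry.ShimuraVarieties.UnitaryBallLieDerivative
import Mathlib.LinearAlgebra.Matrix.Reindex
import HarnessLib

/-!
# FLOOR-0 P2a — S2⁺ piece L2c, CONSUMER side: «ordered products + `z₀`-weights» in the F3 frame (`sig_L2C`)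

Cell hodgecm-mathlib (D-0151), FLOOR 0, crux item H413 = stmt-HodgeConjecture-24833, programme P2a (B4 archimedean desk), line of record
`Cruxes/H413/Lines/F0_P2aCohIsotypicLine.lean` (fe64be0a), stub S2⁺ `stub_archOrth_hol : ArchOrthHolType`, reference chain
`L2a → L2b → L2c → L2d → L2e` of the lead's CUT v2 (`F0/P2a/F0P2a-p01/CUT-S2plus-signatures.v2.lean` 47a407da, ACCEPTED as the ED. 3 registration
basis, desk integrator F0P2a-plan (g3) 2026-08-30T23:34Z).  THIS FILE = the L2c CONSUMER (desk rulings v3.1 (R3): hand F0P2a-p08 (g0)): the head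
`sig_L2C_holds` has the TYPE of the cut's `sig_L2C` in its CUT v3 shape: v2 ll. 28–47 token for token (the `T`-exhaustion clause ll. 48–58 DROPPED —
lead 2026-08-30T23:46:46Z ASK 4) with ONE token pinned — `(𝒢 : AdelicGroupData.{0} K)` for `(𝒢 : AdelicGroupData K)` (desk ruling v3.2 on this seat's
integration catch 23:52Z: the ★ engine files are stated over `Type`-valued carriers while the cut's F3 frame is universe-polymorphic in the datum; the
only datum of the programme, ★ `UnitaryGroup.adelicGroupData`, IS `AdelicGroupData.{0}`).  PROOF lane
(theorems only: no `def`, no instance, no notation, no named fact, no `sorry`); `--supports stmt-HodgeConjecture-24833 --as helper`.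
HC_CM is proved only modulo the 7 printed citations until rung 0 closes; this file proves nothing about them.

ENGINE (imported, not rebuilt): A-p08 (g15)'s ★ `Theorems/F0P2aL2cPNullSpanOrthogonal.exists_stable_orthogonal` (for `ρ𝔤 : 𝔲(α,β) →ₗ⁅ℝ⁆ End_ℂ W`,
a finite-dimensional NULL CORE `E` — `pOp μ x_s` kills `E`, `E` is `𝔨`-stable, of `h`-weight `w` with `⁅h, ·⁆ = r⁅z₀, ·⁆` — a class map `T : W →ₗ H`
with `ρ𝔤 h` skew, and `b` of weight `w` with `⟪T E, T b⟫ = 0`: the `𝔤`-span `S = U(𝔤)·E` is `ρ𝔤`-stable and `⟪T S, T b⟫ = 0`) over F0P3-p01's ★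
`F0P3bPPartOperators` ∕ `F0P3bPNullGeneration`, and A-p08's ★ dictionary `Theorems/F0P2aL2cEngineDictionary` (`pNull_of_CR`: Cauchy–Riemann ⇒ null
core with `μ = i`; the weight element `2 z₀ − i·1`, `⁅2 z₀ − i·1, ·⁆ = 2 • ⁅z₀, ·⁆`, with matrix `i · diag(1_α, −1_β)`).
THIS FILE is the change of coordinates from the engine's `𝔲(diag(1,1,−1))` on `Fin 2 ⊕ Fin 1` to the cut's `𝔲(2,1) = BallForms.u21Group.lie` on
`Fin 3`, and the analytic plumbing of the F3 frame:
* §1 REINDEX BRIDGE along `e = finSumFinEquiv : Fin 2 ⊕ Fin 1 ≃ Fin 3`: `reindex e e (diag(1_2, −1_1)) = J`; `reindex` is a real Lie algebra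
  ISOMORPHISM `𝔲(α,β) ≅ 𝔲(2,1)` (`exists_lieHom_reindex`: a Lie homomorphism with a two-sided inverse); images of the engine's frame:
  `X_{cE_{a0}} ↦ X_b`, `b = Pi.single a c` (`reindex_upqUnit`); `2 z₀ − i·1 ↦ i·J` (the cut's `h₀`); `Y ∈ 𝔨 ⇔` its image commutes with `J`;
* §2 the F3 FRAME as an ★ `AutomorphyDatum` (`arch := u21Group`, `ofArch := ι`, trivial finite-adelic data — a LOCAL term inside two proofs, never a
  definition): p02's ★ `IsLieStableSmooth.exists_lieHom` (ANY datum) gives `ρ : 𝔲(2,1) →ₗ⁅ℝ⁆ End_ℂ W`, `ρ X φ = X φ`; ★ `inner_lieDeriv_toLp_left`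
  gives the skew-adjointness of `X ∈ 𝔲(2,1)` for the class map `T := l2ClassOf ∘ inclusion : W → L²(μ)` (★ `AdelicGroupData.l2ClassOf`; NO
  injectivity needed or assumed);
* §3 the head `sig_L2C_holds`: the engine at `ρ𝔤 := ρ ∘ r`, `μ := i`, `h := 2 z₀ − i·1`, `E := V` pulled back to `W`, `b := ψ₃`; `S` pushed forward
  along `W ↪ (𝒢.Adelic → ℂ)`.

## References
* [BorelWallach2000] A. Borel, N. Wallach, *Continuous cohomology, discrete subgroups, and representations of reductive groups*, 2nd ed.
  (2000), II §4.1 (the `𝔭^±`-grading of the `(𝔤,K)`-module generated by a `𝔭⁻`-null `K`-type; `z₀`-weights).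
* [Borel1997] A. Borel, *Automorphic forms on SL₂(ℝ)* (1997), 11.12 (2) (`(Xφ, ψ) = −(φ, Xψ)` on smooth square-integrable vectors).
* [HarishChandraTAMS1953] Harish-Chandra, *Representations of a semisimple Lie group on a Banach space. I*, Trans. AMS 75 (1953), §7, §9.
* [Knapp2002] A. W. Knapp, *Lie Groups Beyond an Introduction*, 2nd ed., I.§1 Example (3) (`𝔲(p,q)`), I.§10.
* Tree: ★ `Theorems/F0P2aL2cPNullSpanOrthogonal`, ★ `Theorems/F0P2aL2cEngineDictionary` (A-p08), ★ `Theorems/F0P3bPPartOperators` ∕ `F0P3bPNullGeneration`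
  (F0P3-p01), ★ `Literature/…/AutomorphicAnalyticVectorsGeneral` (F0P2a-p02), ★ `…/AutomorphicLieDerivSkewAdjoint`, ★ `…/AutomorphicRepsGLClosureRegularity`,
  ★ `…/UnitaryBallLieDerivative` (`u21Group`, `liePMat`), ★ `…/UpqHodgeBigrading` (`upqZ0`, `lie_upqZ0_upqUnit`), ★ `…/UpqLefschetzDecomposition` (`upqUnit`).
-/

-- Mathlib idiom (as in the engine files): commutator bracket on `Module.End` / matrices
attribute [local instance 100] LieRing.ofAssociativeRing

set_option autoImplicit false
set_option linter.dupNamespace false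

noncomputable section

open MeasureTheory NumberField
open scoped InnerProductSpace ENNReal ComplexOrder Matrix ComplexConjugate

namespace Summit.HodgeConjecture.HodgeConjecture.Cruxes.H413.F0P2aL2cOrderedProducts

open Literature.NumberTheory.Automorphic
open Literature.AlgebraicGeometry.ShimuraVarieties (BallForms.u21Group BallForms.liePMat)
open Literature.Geometry.ComplexHyperbolic.BallModel (U21)
open Literature.AlgebraicGeometry.ShimuraVarieties.BallForms (u21Lie mem_u21Lie_iff u21Group_lie coe_liePMat pMat)
open Literature.Geometry.ComplexHyperbolic.BallModel (J J_mul_J)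
open Literature.RepresentationTheory.BorelWallach2000
open Literature.RepresentationTheory.KonnoKonno2007 Literature.RepresentationTheory.KonnoKonno2007.RealDualPair
open Literature.RepresentationTheory.KonnoKonno2007.RealDualPair.UForm
open Summit.HodgeConjecture.HodgeConjecture.Cruxes.H413.F0P3bPPartOperators
open Summit.HodgeConjecture.HodgeConjecture.Cruxes.H413.F0P3bPNullGeneration
open Summit.HodgeConjecture.HodgeConjecture.Cruxes.H413.F0P2aL2cPNullSpanOrthogonal
open Summit.HodgeConjecture.HodgeConjecture.Cruxes.H413.F0P2aL2cEngineDictionary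

/-! ## §1 The reindex bridge `𝔲(diag(1_2, −1_1)) ≅ 𝔲(2,1)` along `finSumFinEquiv : Fin 2 ⊕ Fin 1 ≃ Fin 3` -/

section Reindex

/-- `e.symm 0 = inl 0` for `e = finSumFinEquiv : Fin 2 ⊕ Fin 1 ≃ Fin 3`. [folklore] -/
theorem finSumFinEquiv_symm_zero : (finSumFinEquiv : Fin 2 ⊕ Fin 1 ≃ Fin 3).symm 0 = Sum.inl 0 := by decide
/-- `e.symm 1 = inl 1`. [folklore] -/
theorem finSumFinEquiv_symm_one : (finSumFinEquiv : Fin 2 ⊕ Fin 1 ≃ Fin 3).symm 1 = Sum.inl 1 := by decide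
/-- `e.symm 2 = inr 0`. [folklore] -/
theorem finSumFinEquiv_symm_two : (finSumFinEquiv : Fin 2 ⊕ Fin 1 ≃ Fin 3).symm 2 = Sum.inr 0 := by decide

/-- **`reindex e e (diag(1, 1, −1) on Fin 2 ⊕ Fin 1) = J`** (the tree's `BallModel.J = diagonal ![1, 1, −1]`). [cite: Knapp2002, I §1 Example (3)] -/
theorem reindex_signForm_eq_J :
    Matrix.reindex (finSumFinEquiv : Fin 2 ⊕ Fin 1 ≃ Fin 3) (finSumFinEquiv : Fin 2 ⊕ Fin 1 ≃ Fin 3)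
      (RealDualPair.signForm (Fin 2) (Fin 1)) = J := by
  ext i j
  fin_cases i <;> fin_cases j <;>
    simp [RealDualPair.signForm_eq_diagonal, J, Matrix.reindex_apply, Matrix.submatrix_apply, finSumFinEquiv_symm_zero,
      finSumFinEquiv_symm_one, finSumFinEquiv_symm_two]

/-- `reindex e.symm e.symm J = diag(1_2, −1_1)`. [folklore] -/
theorem reindex_symm_J_eq_signForm :
    Matrix.reindex (finSumFinEquiv : Fin 2 ⊕ Fin 1 ≃ Fin 3).symm (finSumFinEquiv : Fin 2 ⊕ Fin 1 ≃ Fin 3).symm J =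
      RealDualPair.signForm (Fin 2) (Fin 1) := by
  rw [← reindex_signForm_eq_J]
  ext i j
  simp [Matrix.reindex_apply, Matrix.submatrix_apply]

/-- **`reindex` carries `𝔲(diag(1_2,−1_1))` into `𝔲(2,1)`**: `Xᴴ D + D X = 0 ⇒ (reindex X)ᴴ J + J (reindex X) = 0`. [cite: Knapp2002, I §1 Example (3)] -/
theorem reindex_mem_u21Lie {X : Matrix (Fin 2 ⊕ Fin 1) (Fin 2 ⊕ Fin 1) ℂ} (hX : X ∈ (uFormGroup (Fin 2) (Fin 1)).lie) :
    Matrix.reindex (finSumFinEquiv : Fin 2 ⊕ Fin 1 ≃ Fin 3) (finSumFinEquiv : Fin 2 ⊕ Fin 1 ≃ Fin 3) X ∈ BallForms.u21Group.lie := by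
  rw [mem_uFormGroup_lie_iff] at hX
  rw [u21Group_lie, mem_u21Lie_iff, ← reindex_signForm_eq_J, Matrix.conjTranspose_reindex, ← Matrix.coe_reindexAlgEquiv ℂ ℂ,
    ← map_mul, ← map_mul, ← map_add, hX, map_zero]

/-- … and `reindex e.symm e.symm` carries `𝔲(2,1)` back into `𝔲(diag(1_2,−1_1))`. [cite: Knapp2002, I §1 Example (3)] -/
theorem reindex_symm_mem_uFormGroup_lie {Y : Matrix (Fin 3) (Fin 3) ℂ} (hY : Y ∈ BallForms.u21Group.lie) :
    Matrix.reindex (finSumFinEquiv : Fin 2 ⊕ Fin 1 ≃ Fin 3).symm (finSumFinEquiv : Fin 2 ⊕ Fin 1 ≃ Fin 3).symm Y ∈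
      (uFormGroup (Fin 2) (Fin 1)).lie := by
  rw [u21Group_lie, mem_u21Lie_iff] at hY
  rw [mem_uFormGroup_lie_iff, ← reindex_symm_J_eq_signForm, Matrix.conjTranspose_reindex, ← Matrix.coe_reindexAlgEquiv ℂ ℂ,
    ← map_mul, ← map_mul, ← map_add, hY, map_zero]

/-- `reindex` is multiplicative up to the commutator: `reindex (XY − YX) = reindex X · reindex Y − reindex Y · reindex X`. [folklore] -/
theorem reindex_commutator (X Y : Matrix (Fin 2 ⊕ Fin 1) (Fin 2 ⊕ Fin 1) ℂ) :
    Matrix.reindex (finSumFinEquiv : Fin 2 ⊕ Fin 1 ≃ Fin 3) (finSumFinEquiv : Fin 2 ⊕ Fin 1 ≃ Fin 3) (X * Y - Y * X) =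
      Matrix.reindex (finSumFinEquiv : Fin 2 ⊕ Fin 1 ≃ Fin 3) (finSumFinEquiv : Fin 2 ⊕ Fin 1 ≃ Fin 3) X *
          Matrix.reindex (finSumFinEquiv : Fin 2 ⊕ Fin 1 ≃ Fin 3) (finSumFinEquiv : Fin 2 ⊕ Fin 1 ≃ Fin 3) Y -
        Matrix.reindex (finSumFinEquiv : Fin 2 ⊕ Fin 1 ≃ Fin 3) (finSumFinEquiv : Fin 2 ⊕ Fin 1 ≃ Fin 3) Y *
          Matrix.reindex (finSumFinEquiv : Fin 2 ⊕ Fin 1 ≃ Fin 3) (finSumFinEquiv : Fin 2 ⊕ Fin 1 ≃ Fin 3) X := by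
  rw [← Matrix.coe_reindexAlgEquiv ℂ ℂ, map_sub, map_mul, map_mul]

/-- **THE REINDEX LIE ISOMORPHISM `r : 𝔲(diag(1_2,−1_1)) → 𝔲(2,1)`** (as a real Lie algebra homomorphism with an explicit two-sided inverse,
both given by `Matrix.reindex` along `finSumFinEquiv`). [cite: Knapp2002, I §1 Example (3)] -/
theorem exists_lieHom_reindex :
    ∃ (r : (uFormGroup (Fin 2) (Fin 1)).lie →ₗ⁅ℝ⁆ BallForms.u21Group.lie) (s : BallForms.u21Group.lie → (uFormGroup (Fin 2) (Fin 1)).lie),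
      (∀ X, ((r X : BallForms.u21Group.lie) : Matrix (Fin 3) (Fin 3) ℂ) =
          Matrix.reindex (finSumFinEquiv : Fin 2 ⊕ Fin 1 ≃ Fin 3) (finSumFinEquiv : Fin 2 ⊕ Fin 1 ≃ Fin 3)
            (X : Matrix (Fin 2 ⊕ Fin 1) (Fin 2 ⊕ Fin 1) ℂ)) ∧
      (∀ Y, ((s Y : (uFormGroup (Fin 2) (Fin 1)).lie) : Matrix (Fin 2 ⊕ Fin 1) (Fin 2 ⊕ Fin 1) ℂ) =
          Matrix.reindex (finSumFinEquiv : Fin 2 ⊕ Fin 1 ≃ Fin 3).symm (finSumFinEquiv : Fin 2 ⊕ Fin 1 ≃ Fin 3).symm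
            (Y : Matrix (Fin 3) (Fin 3) ℂ)) ∧
      (∀ Y, r (s Y) = Y) := by
  refine ⟨{ toFun := fun X => ⟨Matrix.reindex finSumFinEquiv finSumFinEquiv (X : Matrix (Fin 2 ⊕ Fin 1) (Fin 2 ⊕ Fin 1) ℂ),
              reindex_mem_u21Lie X.2⟩
            map_add' := fun X Y => Subtype.ext rfl
            map_smul' := fun t X => Subtype.ext rfl
            map_lie' := ?_ },
          fun Y => ⟨Matrix.reindex finSumFinEquiv.symm finSumFinEquiv.symm (Y : Matrix (Fin 3) (Fin 3) ℂ),
            reindex_symm_mem_uFormGroup_lie Y.2⟩, fun X => rfl, fun Y => rfl, fun Y => ?_⟩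
  · intro X Y
    apply Subtype.ext
    change Matrix.reindex (finSumFinEquiv : Fin 2 ⊕ Fin 1 ≃ Fin 3) (finSumFinEquiv : Fin 2 ⊕ Fin 1 ≃ Fin 3)
        (((⁅X, Y⁆ : (uFormGroup (Fin 2) (Fin 1)).lie)) : Matrix (Fin 2 ⊕ Fin 1) (Fin 2 ⊕ Fin 1) ℂ) =
      ((⁅(⟨Matrix.reindex (finSumFinEquiv : Fin 2 ⊕ Fin 1 ≃ Fin 3) (finSumFinEquiv : Fin 2 ⊕ Fin 1 ≃ Fin 3)
            (X : Matrix (Fin 2 ⊕ Fin 1) (Fin 2 ⊕ Fin 1) ℂ), reindex_mem_u21Lie X.2⟩ : BallForms.u21Group.lie),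
         (⟨Matrix.reindex (finSumFinEquiv : Fin 2 ⊕ Fin 1 ≃ Fin 3) (finSumFinEquiv : Fin 2 ⊕ Fin 1 ≃ Fin 3)
            (Y : Matrix (Fin 2 ⊕ Fin 1) (Fin 2 ⊕ Fin 1) ℂ), reindex_mem_u21Lie Y.2⟩ : BallForms.u21Group.lie)⁆ : BallForms.u21Group.lie) :
        Matrix (Fin 3) (Fin 3) ℂ)
    rw [LieSubalgebra.coe_bracket, LieSubalgebra.coe_bracket, Ring.lie_def, Ring.lie_def]
    exact reindex_commutator _ _
  · apply Subtype.ext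
    change Matrix.reindex (finSumFinEquiv : Fin 2 ⊕ Fin 1 ≃ Fin 3) (finSumFinEquiv : Fin 2 ⊕ Fin 1 ≃ Fin 3)
        (Matrix.reindex (finSumFinEquiv : Fin 2 ⊕ Fin 1 ≃ Fin 3).symm (finSumFinEquiv : Fin 2 ⊕ Fin 1 ≃ Fin 3).symm
          (Y : Matrix (Fin 3) (Fin 3) ℂ)) = (Y : Matrix (Fin 3) (Fin 3) ℂ)
    ext i j
    simp [Matrix.reindex_apply, Matrix.submatrix_apply]

/-- **The image of the engine's frame element `X_{cE_{a,0}}` is the cut's `X_b`, `b = Pi.single a c`** (`reindex` of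
`fromBlocks 0 (cE_{a0}) (cE_{a0})ᴴ 0` is `pMat (Pi.single a c)`). [cite: BorelWallach2000, VI 4.8 (3)] -/
theorem reindex_upqUnit (a : Fin 2) (c : ℂ) :
    Matrix.reindex (finSumFinEquiv : Fin 2 ⊕ Fin 1 ≃ Fin 3) (finSumFinEquiv : Fin 2 ⊕ Fin 1 ≃ Fin 3)
      ((upqUnit (a, (0 : Fin 1)) c : (uFormGroup (Fin 2) (Fin 1)).lie) : Matrix (Fin 2 ⊕ Fin 1) (Fin 2 ⊕ Fin 1) ℂ) =
      pMat (Pi.single a c) := by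
  ext i j
  fin_cases a <;> fin_cases i <;> fin_cases j <;>
    simp [pMat, Matrix.reindex_apply, Matrix.submatrix_apply, finSumFinEquiv_symm_zero, finSumFinEquiv_symm_one, finSumFinEquiv_symm_two,
      Matrix.fromBlocks_apply₁₁, Matrix.fromBlocks_apply₁₂, Matrix.fromBlocks_apply₂₁, Matrix.fromBlocks_apply₂₂]

/-- Every direction `p : Fin 2 × Fin 1` is `(p.1, 0)`. [folklore] -/
theorem prod_fin_one_eq (p : Fin 2 × Fin 1) : p = (p.1, (0 : Fin 1)) := by
  obtain ⟨a, b⟩ := p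
  exact Prod.ext rfl (Subsingleton.elim _ _)

/-- **The image of the weight element `2 z₀ − i·1` is `i·J`** (the cut's `h₀`). [cite: BorelWallach2000, II §4.1] -/
theorem reindex_two_smul_upqZ0_sub_I :
    Matrix.reindex (finSumFinEquiv : Fin 2 ⊕ Fin 1 ≃ Fin 3) (finSumFinEquiv : Fin 2 ⊕ Fin 1 ≃ Fin 3)
      ((((2 : ℝ) • upqZ0 (Fin 2) (Fin 1) -
          ⟨Complex.I • (1 : Matrix (Fin 2 ⊕ Fin 1) (Fin 2 ⊕ Fin 1) ℂ), I_smul_one_mem_lie⟩ : (uFormGroup (Fin 2) (Fin 1)).lie)) :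
        Matrix (Fin 2 ⊕ Fin 1) (Fin 2 ⊕ Fin 1) ℂ) = Complex.I • J := by
  rw [coe_two_smul_upqZ0_sub_I_eq_smul_signForm, ← reindex_signForm_eq_J]
  rfl

/-- For `Y ∈ 𝔲(2,1)`: `Y` commutes with `J` iff `Y` is skew-hermitian (`Yᴴ J + J Y = 0` and `J² = 1`). [cite: Knapp2002, I §1 Example (3)] -/
theorem mul_J_eq_iff_conjTranspose_eq_neg (Y : BallForms.u21Group.lie) :
    (Y : Matrix (Fin 3) (Fin 3) ℂ) * J = J * (Y : Matrix (Fin 3) (Fin 3) ℂ) ↔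
      (Y : Matrix (Fin 3) (Fin 3) ℂ)ᴴ = -(Y : Matrix (Fin 3) (Fin 3) ℂ) := by
  have hY : (Y : Matrix (Fin 3) (Fin 3) ℂ)ᴴ * J + J * (Y : Matrix (Fin 3) (Fin 3) ℂ) = 0 := Y.2
  have hY' : (Y : Matrix (Fin 3) (Fin 3) ℂ)ᴴ * J = -(J * (Y : Matrix (Fin 3) (Fin 3) ℂ)) := eq_neg_of_add_eq_zero_left hY
  constructor
  · intro h
    rw [← h] at hY'
    have h2 := congrArg (fun M : Matrix (Fin 3) (Fin 3) ℂ => M * J) hY'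
    simp only [Matrix.mul_assoc, J_mul_J, Matrix.mul_one, neg_mul] at h2
    exact h2
  · intro h
    rw [h, Matrix.neg_mul, neg_inj] at hY'
    exact hY'

/-- For `X ∈ 𝔲(diag(1_2,−1_1))`: `X ∈ 𝔨` iff `X` is skew-hermitian. [cite: Knapp2002, VI §2] -/
theorem mem_kInLie_iff_conjTranspose_eq_neg (X : (uFormGroup (Fin 2) (Fin 1)).lie) :
    X ∈ (uFormGroup (Fin 2) (Fin 1)).kInLie ↔
      (X : Matrix (Fin 2 ⊕ Fin 1) (Fin 2 ⊕ Fin 1) ℂ)ᴴ = -(X : Matrix (Fin 2 ⊕ Fin 1) (Fin 2 ⊕ Fin 1) ℂ) := by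
  rw [RealMatrixGroup.mem_kInLie_iff, RealMatrixGroup.mem_compactLie_iff, and_iff_right X.2, Matrix.star_eq_conjTranspose]

/-- **`𝔨` under the bridge**: for `X ∈ 𝔨 ⊂ 𝔲(diag(1_2,−1_1))`, `reindex X` commutes with `J` (the cut's description of `𝔨 ⊂ 𝔲(2,1)`; both say
«skew-hermitian»). [cite: Knapp2002, I §1 Example (3)] -/
theorem reindex_mul_J_of_mem_kInLie (X : (uFormGroup (Fin 2) (Fin 1)).lie) (Y : BallForms.u21Group.lie)
    (hXY : (Y : Matrix (Fin 3) (Fin 3) ℂ) =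
      Matrix.reindex (finSumFinEquiv : Fin 2 ⊕ Fin 1 ≃ Fin 3) (finSumFinEquiv : Fin 2 ⊕ Fin 1 ≃ Fin 3)
        (X : Matrix (Fin 2 ⊕ Fin 1) (Fin 2 ⊕ Fin 1) ℂ)) (hX : X ∈ (uFormGroup (Fin 2) (Fin 1)).kInLie) :
    (Y : Matrix (Fin 3) (Fin 3) ℂ) * J = J * (Y : Matrix (Fin 3) (Fin 3) ℂ) := by
  rw [mul_J_eq_iff_conjTranspose_eq_neg, hXY, Matrix.conjTranspose_reindex, (mem_kInLie_iff_conjTranspose_eq_neg X).1 hX]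
  rfl

/-- `Pi.single a (i c) = i • Pi.single a c`. [folklore] -/
theorem single_I_mul (a : Fin 2) (c : ℂ) : (Pi.single a (Complex.I * c) : Fin 2 → ℂ) = Complex.I • Pi.single a c := by
  ext k
  by_cases hk : k = a
  · subst hk; simp
  · simp [hk]

end Reindex

/-! ## §2 The F3 frame as an automorphy datum: the Lie representation on `W` and skew-adjointness of the class map -/

section Frame

variable {K : Type} [Field K] [NumberField K]

/-- **The Lie derivatives form a real Lie representation of `𝔲(2,1)` on a Lie-stable space of `ι`-smooth functions** (F3 frame; p02's ★
`IsLieStableSmooth.exists_lieHom` at the datum `(u21Group, ι)`). [cite: HarishChandraTAMS1953, §7] -/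
theorem exists_lieHom_lieDeriv_u21 (𝒢 : AdelicGroupData.{0} K) (ι : ↥U21 →* 𝒢.Adelic) (hι : Continuous ι)
    (W : Submodule ℂ (𝒢.Adelic → ℂ)) (hsm : ∀ φ ∈ W, IsArchSmooth (H := BallForms.u21Group) ι φ)
    (hlie : ∀ (X : BallForms.u21Group.lie), ∀ φ ∈ W, lieDeriv (H := BallForms.u21Group) ι X φ ∈ W) :
    ∃ ρ : BallForms.u21Group.lie →ₗ⁅ℝ⁆ Module.End ℂ W,
      ∀ (X : BallForms.u21Group.lie) (φ : W), ((ρ X φ : W) : 𝒢.Adelic → ℂ) = lieDeriv (H := BallForms.u21Group) ι X φ :=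
  IsLieStableSmooth.exists_lieHom
    (𝒟 := { arch := BallForms.u21Group, ofArch := ι, continuous_ofArch := hι, finiteAdelic := ⊥,
            commute_ofArch := fun g h hh => by rw [Subgroup.mem_bot] at hh; rw [hh, mul_one, one_mul],
            finiteLevels := {⊥}, finiteLevels_nonempty := Set.singleton_nonempty ⊥,
            le_finiteAdelic := fun U hU => le_of_eq (Set.mem_singleton_iff.1 hU), height := fun _ => 0 })
    ⟨hsm, hlie⟩

/-- **Skew-adjointness of `X ∈ 𝔲(2,1)` on `L²(μ)` in the F3 frame** (`⟪[f_X], [g]⟫ = −⟪[f], [g_X]⟫`; ★ `inner_lieDeriv_toLp_left` at the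
datum `(u21Group, ι)`). [cite: Borel1997, 11.12 (2)] -/
theorem inner_toLp_lieDeriv_left_u21 (𝒢 : AdelicGroupData.{0} K) (ι : ↥U21 →* 𝒢.Adelic) (hι : Continuous ι)
    {μ : Measure 𝒢.automorphicQuotient} [𝒢.IsAutomorphicMeasure μ] {f f_X g g_X : 𝒢.automorphicQuotient → ℂ}
    (hf : MemLp f 2 μ) (hfX : MemLp f_X 2 μ) (hg : MemLp g 2 μ) (hgX : MemLp g_X 2 μ)
    (hφ : IsArchSmooth (H := BallForms.u21Group) ι (invQuot 𝒢 f)) (hψ : IsArchSmooth (H := BallForms.u21Group) ι (invQuot 𝒢 g))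
    (X : BallForms.u21Group.lie) (hXf : lieDeriv (H := BallForms.u21Group) ι X (invQuot 𝒢 f) = invQuot 𝒢 f_X)
    (hXg : lieDeriv (H := BallForms.u21Group) ι X (invQuot 𝒢 g) = invQuot 𝒢 g_X) :
    ⟪hfX.toLp f_X, hg.toLp g⟫_ℂ = -⟪hf.toLp f, hgX.toLp g_X⟫_ℂ :=
  inner_lieDeriv_toLp_left
    ({ arch := BallForms.u21Group, ofArch := ι, continuous_ofArch := hι, finiteAdelic := ⊥,
       commute_ofArch := fun g h hh => by rw [Subgroup.mem_bot] at hh; rw [hh, mul_one, one_mul],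
       finiteLevels := {⊥}, finiteLevels_nonempty := Set.singleton_nonempty ⊥,
       le_finiteAdelic := fun U hU => le_of_eq (Set.mem_singleton_iff.1 hU), height := fun _ => 0 } : AutomorphyDatum 𝒢 ℂ (Fin 3))
    hf hfX hg hgX hφ hψ X hXf hXg

end Frame

/-! ## §3 The head: `sig_L2C` of the lead's CUT (v3 shape), token for token, frame pinned to `AdelicGroupData.{0}` -/

/-- **L2c, CONSUMER SHAPE (`sig_L2C`)** — ORDERED PRODUCTS + `z₀`-WEIGHTS in the F3 frame: `W` a Lie-stable space of `ι`-smooth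
`L²`-representable functions; `V ≤ W` finite-dimensional, `𝔨`-stable, `𝔭⁻`-null (CR form), `h₀`-eigen (`h₀ = i·J`, eigenvalue `c`);
`ψ₃ ∈ W` `h₀`-eigen with the same `c` and `[ψ₃] ⊥ [V]`.  THEN the `𝔤`-span of `V` sits in a Lie-stable `S`, `V ≤ S ≤ W`, with `[ψ₃] ⊥ [S]`
(CUT v3 shape: v2 ll. 28–47 with the datum pinned to universe `0` and the `T`-exhaustion clause dropped — lead 23:46:46Z ASK 4, desk ruling v3.2).
Proof: the engine ★ `exists_stable_orthogonal` transported along §1–§2.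
[cite: BorelWallach2000, II §4.1] [cite: Borel1997, 11.12 (2)] [cite: HarishChandraTAMS1953, §9] -/
theorem sig_L2C_holds :
  ∀ {K : Type} [Field K] [NumberField K] (𝒢 : AdelicGroupData.{0} K) (ι : ↥U21 →* 𝒢.Adelic), Continuous ι →
    ∀ (μ : Measure 𝒢.automorphicQuotient) [𝒢.IsAutomorphicMeasure μ] (W : Submodule ℂ (𝒢.Adelic → ℂ)),
    (∀ φ ∈ W, IsArchSmooth (H := BallForms.u21Group) ι φ) →
    (∀ (X : BallForms.u21Group.lie), ∀ φ ∈ W, lieDeriv (H := BallForms.u21Group) ι X φ ∈ W) →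
    W ≤ 𝒢.l2Representable μ →
    ∀ (h₀ : BallForms.u21Group.lie), (h₀ : Matrix (Fin 3) (Fin 3) ℂ) = Complex.I • Literature.Geometry.ComplexHyperbolic.BallModel.J →
    ∀ (c : ℂ) (V : Submodule ℂ (𝒢.Adelic → ℂ)), V ≤ W → FiniteDimensional ℂ V →
    (∀ Y : BallForms.u21Group.lie, (Y : Matrix (Fin 3) (Fin 3) ℂ) * Literature.Geometry.ComplexHyperbolic.BallModel.J =
        Literature.Geometry.ComplexHyperbolic.BallModel.J * (Y : Matrix (Fin 3) (Fin 3) ℂ) →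
      ∀ φ ∈ V, lieDeriv (H := BallForms.u21Group) ι Y φ ∈ V) →
    (∀ (b : Fin 2 → ℂ), ∀ φ ∈ V, lieDeriv (H := BallForms.u21Group) ι (BallForms.liePMat (Complex.I • b)) φ =
      Complex.I • lieDeriv (H := BallForms.u21Group) ι (BallForms.liePMat b) φ) →
    (∀ φ ∈ V, lieDeriv (H := BallForms.u21Group) ι h₀ φ = c • φ) →
    ∀ ψ₃ ∈ W, lieDeriv (H := BallForms.u21Group) ι h₀ ψ₃ = c • ψ₃ →
    ∀ (f₃ : 𝒢.automorphicQuotient → ℂ) (hf₃ : MemLp f₃ 2 μ), invQuot 𝒢 f₃ = ψ₃ →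
    (∀ φ ∈ V, ∀ (f : 𝒢.automorphicQuotient → ℂ) (hf : MemLp f 2 μ), invQuot 𝒢 f = φ → ⟪hf.toLp f, hf₃.toLp f₃⟫_ℂ = 0) →
    ∃ S : Submodule ℂ (𝒢.Adelic → ℂ), V ≤ S ∧ S ≤ W ∧
      (∀ (X : BallForms.u21Group.lie), ∀ φ ∈ S, lieDeriv (H := BallForms.u21Group) ι X φ ∈ S) ∧
      (∀ φ ∈ S, ∀ (f : 𝒢.automorphicQuotient → ℂ) (hf : MemLp f 2 μ), invQuot 𝒢 f = φ → ⟪hf.toLp f, hf₃.toLp f₃⟫_ℂ = 0) := by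
  intro K _ _ 𝒢 ι hι μ _ W hsm hlie hW h₀ hh₀ c V hVW hVfd hVk hCR hVh ψ₃ hψ₃W hψ₃h f₃ hf₃ hf₃ψ hVorth
  classical
  -- §2: the Lie derivatives as a real Lie representation of `𝔲(2,1)` on `W`
  obtain ⟨ρ, hρ⟩ := exists_lieHom_lieDeriv_u21 𝒢 ι hι W hsm hlie
  -- §1: the reindex bridge `rx : 𝔲(diag(1,1,−1)) → 𝔲(2,1)` with inverse `sx`
  obtain ⟨rx, sx, hrx, -, hrs⟩ := exists_lieHom_reindex
  -- the engine's representation `ρ𝔤 := ρ ∘ rx`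
  obtain ⟨ρ𝔤, hρ𝔤⟩ : ∃ ρ𝔤 : (uFormGroup (Fin 2) (Fin 1)).lie →ₗ⁅ℝ⁆ Module.End ℂ W,
      ∀ (X : (uFormGroup (Fin 2) (Fin 1)).lie) (φ : W),
        ((ρ𝔤 X φ : W) : 𝒢.Adelic → ℂ) = lieDeriv (H := BallForms.u21Group) ι (rx X) φ :=
    ⟨ρ.comp rx, fun X φ => hρ (rx X) φ⟩
  -- the class map `T := l2ClassOf ∘ (W ↪ l2Representable)` (no injectivity needed)
  obtain ⟨T, hTrep⟩ : ∃ T : W →ₗ[ℂ] 𝒢.L2 μ,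
      ∀ φ : W, T φ = (𝒢.memLp_l2Rep (μ := μ) ⟨(φ : 𝒢.Adelic → ℂ), hW φ.2⟩).toLp (𝒢.l2Rep (μ := μ) ⟨(φ : 𝒢.Adelic → ℂ), hW φ.2⟩) :=
    ⟨𝒢.l2ClassOf μ ∘ₗ Submodule.inclusion hW, fun φ => rfl⟩
  have hT : ∀ (φ : W) (f : 𝒢.automorphicQuotient → ℂ) (hf : MemLp f 2 μ), invQuot 𝒢 f = φ → T φ = hf.toLp f := by
    intro φ f hf hfφ
    rw [hTrep]
    exact 𝒢.l2ClassOf_eq (φ := ⟨(φ : 𝒢.Adelic → ℂ), hW φ.2⟩) hf hfφ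
  -- the images of the engine's frame under the bridge
  have hrU : ∀ (a : Fin 2) (c' : ℂ), rx (upqUnit (a, (0 : Fin 1)) c') = BallForms.liePMat (Pi.single a c') := by
    intro a c'
    apply Subtype.ext
    rw [hrx, reindex_upqUnit]
    rfl
  have hrh : rx ((2 : ℝ) • upqZ0 (Fin 2) (Fin 1) -
      ⟨Complex.I • (1 : Matrix (Fin 2 ⊕ Fin 1) (Fin 2 ⊕ Fin 1) ℂ), I_smul_one_mem_lie⟩) = h₀ := by
    apply Subtype.ext
    rw [hrx, reindex_two_smul_upqZ0_sub_I, hh₀]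
  -- the null core `E := V` (pulled back to `W`), finite-dimensional
  haveI hVfd' : FiniteDimensional ℂ V := hVfd
  haveI : FiniteDimensional ℂ (Submodule.comap W.subtype V) :=
    LinearEquiv.finiteDimensional (Submodule.comapSubtypeEquivOfLe hVW).symm
  -- (CR) ⇒ null core with `μ = i`
  have hCR' : ∀ (p : Fin 2 × Fin 1) (c' : ℂ), ∀ e ∈ Submodule.comap W.subtype V,
      ρ𝔤 (upqUnit p (Complex.I * c')) e = Complex.I • ρ𝔤 (upqUnit p c') e := by
    intro p c' e he
    rw [prod_fin_one_eq p]
    apply Subtype.ext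
    rw [Submodule.coe_smul, hρ𝔤, hρ𝔤, hrU, hrU, single_I_mul]
    exact hCR (Pi.single p.1 c') e he
  have hEn := pNull_of_CR (ρ𝔤 := ρ𝔤) hCR'
  -- `E` is `𝔨`-stable
  have hEk : ∀ Y ∈ (uFormGroup (Fin 2) (Fin 1)).kInLie, ∀ e ∈ Submodule.comap W.subtype V,
      ρ𝔤 Y e ∈ Submodule.comap W.subtype V := by
    intro Y hY e he
    rw [Submodule.mem_comap, Submodule.subtype_apply, hρ𝔤]
    exact hVk (rx Y) (reindex_mul_J_of_mem_kInLie Y (rx Y) (hrx Y) hY) e he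
  -- the weight element `2 z₀ − i·1 ↦ h₀`: weights on `E` and on `b := ψ₃`
  have hw : ∀ e ∈ Submodule.comap W.subtype V,
      ρ𝔤 ((2 : ℝ) • upqZ0 (Fin 2) (Fin 1) - ⟨Complex.I • (1 : Matrix (Fin 2 ⊕ Fin 1) (Fin 2 ⊕ Fin 1) ℂ), I_smul_one_mem_lie⟩) e =
        c • e := by
    intro e he
    apply Subtype.ext
    rw [Submodule.coe_smul, hρ𝔤, hrh]
    exact hVh e he
  have hb : ρ𝔤 ((2 : ℝ) • upqZ0 (Fin 2) (Fin 1) - ⟨Complex.I • (1 : Matrix (Fin 2 ⊕ Fin 1) (Fin 2 ⊕ Fin 1) ℂ), I_smul_one_mem_lie⟩)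
      (⟨ψ₃, hψ₃W⟩ : W) = c • (⟨ψ₃, hψ₃W⟩ : W) := by
    apply Subtype.ext
    rw [Submodule.coe_smul, hρ𝔤, hrh]
    exact hψ₃h
  -- skew-adjointness of `ρ𝔤 (2 z₀ − i·1) = X_{h₀}` for the class map (integration by parts on the automorphic quotient)
  have hskew : ∀ a b : W,
      ⟪T (ρ𝔤 ((2 : ℝ) • upqZ0 (Fin 2) (Fin 1) - ⟨Complex.I • (1 : Matrix (Fin 2 ⊕ Fin 1) (Fin 2 ⊕ Fin 1) ℂ), I_smul_one_mem_lie⟩) a), T b⟫_ℂ =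
        -⟪T a, T (ρ𝔤 ((2 : ℝ) • upqZ0 (Fin 2) (Fin 1) - ⟨Complex.I • (1 : Matrix (Fin 2 ⊕ Fin 1) (Fin 2 ⊕ Fin 1) ℂ), I_smul_one_mem_lie⟩) b)⟫_ℂ := by
    intro a b
    rw [hTrep, hTrep, hTrep, hTrep]
    refine inner_toLp_lieDeriv_left_u21 𝒢 ι hι _ _ _ _ ?_ ?_ h₀ ?_ ?_
    · rw [AdelicGroupData.invQuot_l2Rep]; exact hsm a a.2
    · rw [AdelicGroupData.invQuot_l2Rep]; exact hsm b b.2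
    · rw [AdelicGroupData.invQuot_l2Rep, AdelicGroupData.invQuot_l2Rep]
      change lieDeriv (H := BallForms.u21Group) ι h₀ (a : 𝒢.Adelic → ℂ) = ((ρ𝔤 _ a : W) : 𝒢.Adelic → ℂ)
      rw [hρ𝔤, hrh]
    · rw [AdelicGroupData.invQuot_l2Rep, AdelicGroupData.invQuot_l2Rep]
      change lieDeriv (H := BallForms.u21Group) ι h₀ (b : 𝒢.Adelic → ℂ) = ((ρ𝔤 _ b : W) : 𝒢.Adelic → ℂ)
      rw [hρ𝔤, hrh]
  -- `[V] ⊥ [ψ₃]`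
  have h0 : ∀ e ∈ Submodule.comap W.subtype V, ⟪T e, T (⟨ψ₃, hψ₃W⟩ : W)⟫_ℂ = 0 := by
    intro e he
    rw [hTrep e, hT ⟨ψ₃, hψ₃W⟩ f₃ hf₃ hf₃ψ]
    exact hVorth (e : 𝒢.Adelic → ℂ) he _ (𝒢.memLp_l2Rep (μ := μ) ⟨(e : 𝒢.Adelic → ℂ), hW e.2⟩)
      (𝒢.invQuot_l2Rep (μ := μ) ⟨(e : 𝒢.Adelic → ℂ), hW e.2⟩)
  -- THE ENGINE
  obtain ⟨S, hES, hSstab, -, hSorth, -⟩ :=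
    exists_stable_orthogonal T (lie_two_smul_upqZ0_sub_I (α := Fin 2) (β := Fin 1)) two_ne_zero Complex.I_mul_I hEn hEk hw hskew hb h0
  -- push forward along `W ↪ (𝒢.Adelic → ℂ)`
  refine ⟨S.map W.subtype, ?_, Submodule.map_subtype_le W S, ?_, ?_⟩
  · intro v hv
    exact ⟨⟨v, hVW hv⟩, hES (show ((⟨v, hVW hv⟩ : W) : 𝒢.Adelic → ℂ) ∈ V from hv), rfl⟩
  · intro X φ hφ
    obtain ⟨t, ht, rfl⟩ := hφ
    refine ⟨ρ𝔤 (sx X) t, hSstab _ t ht, ?_⟩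
    change ((ρ𝔤 (sx X) t : W) : 𝒢.Adelic → ℂ) = lieDeriv (H := BallForms.u21Group) ι X (t : 𝒢.Adelic → ℂ)
    rw [hρ𝔤, hrs]
  · intro φ hφ f hf hfφ
    obtain ⟨t, ht, rfl⟩ := hφ
    have h := hSorth t ht
    rwa [hT t f hf hfφ, hT ⟨ψ₃, hψ₃W⟩ f₃ hf₃ hf₃ψ] at h

end Summit.HodgeConjecture.HodgeConjecture.Cruxes.H413.F0P2aL2cOrderedProducts

end
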